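import Summits.HodgeConjecture.HodgeConjecture.Theorems.Ring2AbelianAllAndreCrossCorrespondence
import Summits.HodgeConjecture.HodgeConjecture.Theorems.Ring2AbelianAllAndreCorrespondenceCategory
import Literature.AlgebraicGeometry.HodgeTheory.LefschetzStandardUnconditionalDegrees
import Literature.AlgebraicTopology.SingularHomology.PoincareDualityCorollaries
import Literature.AlgebraicGeometry.HodgeTheory.LefschetzOneOneHolds
import Literature.AlgebraicGeometry.HodgeTheory.SupportedClassesRationalProofs
import HarnessLib

/-!
# Ring 2 hypotheses, descent face — `B(X)` IN EVERY DEGREE WHOSE TARGET COHOMOLOGY IS ALGEBRAIC: every linear map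
# `H^{2n−2β}(X(ℂ); ℂ) → H^{2β}(X(ℂ); ℂ)` is an algebraic correspondence when `H^{2β}` is spanned by algebraic classes;
# hence `B⋆` for all smooth projective complex THREEFOLDS with `H² = N¹H²` and all FOURFOLDS with `H² = N¹H²`, `H³ = 0`

research route conditional on HC_CM; not a corollary; Q11.4-sentence-2 already refuted in dim ≥ 3.
Cell `pub-hodge-ring2` (Hodge ladder STAGE 3), seat `ring2-b05` (binder row b05
`Ring2.Hypotheses.MotivatedImpliesAlgebraicAV`; parent node `MotivatedImpliesAlgebraic ⟺` binder b10 `B(all)`), gen 42,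
P.S. 2. `HC_CM` does not occur in this file; no case of the Hodge conjecture is proved; the rows below are UNCONDITIONAL
instances of binder b10 (`StandardConjectureBStar`, André's `*_L`-form of Grothendieck's `B(X)`) on the real carriers,
next to the tree's curves / surfaces (literature seat), abelian varieties (Lieberman, ab-andre-2), the strict abelian class
and surjective images (gen 41), Hilbert schemes modulo h74 (gen 41).

THE OBSERVATION (Kleiman 1968 §2 «B(X) holds if X has only algebraic cohomology», the classical argument for Grassmannians /
flag varieties / complete intersections, per degree): `B(X)` in André's form asks, degree by degree, that `*_L : Hᵃ → Hᵇ`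
(`a + b = 2n`) be induced by SOME algebraic class on `X × X`; the degrees `a ≤ n` and `b ≤ 1` are free
(`standardConjectureBStar_iff_inverseLefschetz`). If `b = 2β` and `H^{2β}(X(ℂ); ℂ)` is spanned by algebraic classes
(`algebraicClasses X β = ⊤`), then EVERY linear `ψ : Hᵃ → H^{2β}` is algebraic: with a basis `xᵢ` of `H^{2β}` (algebraic)
and Poincaré duality `Hᵃ ≅ (H^{2β})^∨` (Hatcher 3.38, the tree's `isPerfPair_cupPairing_of_field_holds`), the coordinate
functionals of `ψ` are `c ↦ ⟨c ∪ yᵢ, [X]⟩` for classes `yᵢ ∈ H^{2β}` (algebraic), and `ψ = Σᵢ [xᵢ ⊠ yᵢ]_*` is ab-andre-2's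
cross correspondence (`Ring2.AbelianAll.exists_crossTrace`). No Lefschetz theory, no `HC` of `X × X` is used — contrast the
literature seat's `standardConjectureBStar_of_hodgeClasses_prod_algebraic_range` (input: `HC(X × X)` in codimension `b`).

* §1 `isAlgebraicCorrespondence_of_algebraicClasses_eq_top` — the linear-algebra heart.
* §2 `standardConjectureBStar_of_algebraicClasses_eq_top` — `B⋆(X, η)` for every `η` whenever every EVEN degree `2 ≤ b < n`
  has `H^b = N^{b/2}H^b` and every ODD degree `3 ≤ b < n` has `H^b = 0`; **`standardConjectureBStar_threefold_of_algebraicClasses_one`**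
  (threefolds with `H²(X(ℂ); ℂ) = N¹H²`, i.e. `h^{2,0} = 0`: Fano threefolds, Calabi–Yau threefolds, Enriques-type and
  rationally connected threefolds …; Tankeev 2011 covers `κ(X) < 3` in print, the tree nothing of it),
  `standardConjectureBStar_fourfold_of_algebraicClasses_one` (fourfolds with `H² = N¹H²` and `H³ = 0`: cubic fourfolds,
  Fano fourfolds with `H³ = 0`, …).
* §3 the Hodge-type form: `algebraicClasses_one_eq_top_of_forall_isOfHodgeType` (`h^{2,0} = 0`, i.e. every rational
  degree-2 class of type `(1,1)`, gives `H² = N¹H²` by Lefschetz `(1,1)` and the rational span — both tree theorems), whence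
  **`standardConjectureBStar_threefold_of_forall_isOfHodgeType_one_one`** and the fourfold twin.

No definition, no named fact, no sorry. Honest scope: the degree-2 hypothesis is either the tree's `algebraicClasses X 1 = ⊤`
or its Hodge-type form «every rational class of `H²` is of type `(1,1)`»; no Hodge NUMBER is computed here.
It never holds for the total space of a compact abelian pencil of relative dimension `≥ 1` in degree `2` when `g(S) ≥ 1` or
the pencil is non-isotrivial (transcendental `H¹(S, R¹f_*)`), so the row does NOT touch b05's residue `X`; it is an instance of
b10 only. References: Kleiman1968AlgebraicCycles (§2, Cor. 2.5 ff.: varieties with algebraic cohomology), Grothendieck1968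
(§3 p. 196), HatcherAT2002 (§3.3 Prop. 3.38), VoisinHodgeI2002 (§11.3.3 Lemma 11.41), Tankeev2011 (for comparison only).
-/

noncomputable section

-- every declaration of this problem lives in `Summit.HodgeConjecture.HodgeConjecture.…` (summit = sub-problem)
set_option linter.dupNamespace false

open CategoryTheory AlgebraicGeometry MonoidalCategory
open Literature.AlgebraicTopology.SingularHomology
open Literature.AlgebraicGeometry Literature.AlgebraicGeometry.Motives
  Literature.AlgebraicGeometry.HodgeTheory
open Summit.HodgeConjecture.HodgeConjecture.Ring2.AbelianAll

namespace Summit.HodgeConjecture.HodgeConjecture.Theorems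

variable {n : ℕ} {X : SchemeOver ℂ}

/-! ## §1 Every linear map into an algebraic cohomology group is an algebraic correspondence -/

/-- **If `H^{2β}(X(ℂ); ℂ)` is spanned by algebraic classes, EVERY linear map `ψ : Hᵃ(X(ℂ); ℂ) → H^{2β}(X(ℂ); ℂ)`,
`a + 2β = 2 dim X`, is induced by an algebraic class on `X × X`.** Choose a basis `xᵢ` of `H^{2β}` (algebraic by hypothesis);
by Poincaré duality over `ℂ` (the cup pairing `Hᵃ × H^{2β} → ℂ` is perfect, Hatcher Prop. 3.38 — the tree's
`isPerfPair_cupPairing_of_field_holds`) and the injectivity of ab-andre-2's trace `τ` on `H²ⁿ`, the map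
`y ↦ (c ↦ τ(c ∪ y))` is a bijection `H^{2β} → (Hᵃ)^∨`, so the coordinate functionals of `ψ` are `τ(· ∪ yᵢ)` for classes
`yᵢ ∈ H^{2β}` (algebraic); then `ψ = Σᵢ τ(· ∪ yᵢ) xᵢ` is the cross correspondence `Σᵢ [pr₁^* xᵢ ∪ pr₂^* yᵢ]_*`
(`exists_crossTrace`). [cite: Kleiman1968AlgebraicCycles, §2 (varieties with algebraic cohomology)]
[cite: HatcherAT2002, §3.3 Prop. 3.38] [cite: VoisinHodgeI2002, §11.3.3 Lemma 11.41] -/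
theorem isAlgebraicCorrespondence_of_algebraicClasses_eq_top (hX : IsSmoothProjective n X) {β a : ℕ}
    (hak : a + 2 * β = 2 * n) (htop : algebraicClasses X β = ⊤)
    (ψ : complexBetti X a →ₗ[ℂ] complexBetti X (2 * β)) : IsAlgebraicCorrespondence n n X X ψ := by
  classical
  obtain ⟨τ, hτ, hcross⟩ := exists_crossTrace hX hX
  -- Poincaré duality for the complex orientation of `X(ℂ)`
  letI := hX.chartedSpace
  haveI := ComplexPoints.compactSpace_of_isSmoothProjective hX
  haveI := ComplexPoints.t2Space_of_isSmoothProjective hX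
  haveI : Module.Finite ℂ (complexBetti X a) := finite_complexBetti hX a
  haveI : Module.Finite ℂ (complexBetti X (2 * β)) := finite_complexBetti hX (2 * β)
  set ν := complexOrientationFamily hX with hν
  have hP : (cupPairing ν hak).IsPerfPair := isPerfPair_cupPairing_of_field_holds
  -- the map `y ↦ τ(· ∪ y)` into the dual of `Hᵃ`
  let Φ : complexBetti X (2 * β) →ₗ[ℂ] Module.Dual ℂ (complexBetti X a) :=
    LinearMap.llcomp ℂ (complexBetti X a) (complexBetti X (2 * n)) ℂ τ ∘ₗ (cupProduct hak).flip
  have hΦ_apply : ∀ y c, Φ y c = τ (cupProduct hak c y) := fun _ _ ↦ rfl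
  -- `Φ` is injective: `τ(c ∪ y) = 0` for all `c` forces `c ∪ y = 0` for all `c`, hence `y = 0` by Poincaré duality
  have hΦinj : Function.Injective Φ := by
    rw [← LinearMap.ker_eq_bot, LinearMap.ker_eq_bot']
    intro y hy
    have hzero : ∀ c : complexBetti X a, cupProduct hak c y = 0 := fun c ↦
      hτ _ (by rw [← hΦ_apply, hy, LinearMap.zero_apply])
    have hflip : (cupPairing ν hak).flip y = 0 := by
      refine LinearMap.ext fun c ↦ ?_
      rw [LinearMap.flip_apply, cupPairing_apply, hzero, map_zero, LinearMap.zero_apply, LinearMap.zero_apply]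
    exact hP.bijective_right.1 (by rw [hflip, map_zero])
  -- dimensions agree (Poincaré duality), so `Φ` is surjective
  have hdim : Module.finrank ℂ (complexBetti X (2 * β)) = Module.finrank ℂ (Module.Dual ℂ (complexBetti X a)) :=
    (LinearEquiv.ofBijective (cupPairing ν hak).flip hP.bijective_right).finrank_eq
  have hΦsurj : Function.Surjective Φ :=
    (LinearMap.injective_iff_surjective_of_finrank_eq_finrank hdim).1 hΦinj
  -- coordinates of `ψ` in a basis of `H^{2β}`
  let bs := Module.finBasis ℂ (complexBetti X (2 * β))
  choose y hy using fun i ↦ hΦsurj (bs.coord i ∘ₗ ψ)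
  obtain ⟨T, hT, hTapply⟩ := hcross hak (show β ≤ n by omega) _ (fun i ↦ bs i) y
    (fun i ↦ by rw [htop]; exact Submodule.mem_top) (fun i ↦ by rw [htop]; exact Submodule.mem_top)
  have hψT : ψ = T := by
    refine LinearMap.ext fun c ↦ ?_
    rw [hTapply, ← bs.sum_repr (ψ c)]
    refine Finset.sum_congr rfl fun i _ ↦ ?_
    rw [← hΦ_apply, hy i]
    rfl
  rw [hψT]
  exact hT

/-! ## §2 `B⋆` when the cohomology below the middle is algebraic -/

/-- **`B⋆(X, η)` for every `η`, for a smooth projective complex `n`-fold all of whose cohomology in degrees `2 ≤ b < n` is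
algebraic** — `H^b(X(ℂ); ℂ) = N^{b/2}H^b` for `b` even (`algebraicClasses X (b/2) = ⊤`) and `H^b(X(ℂ); ℂ) = 0` for `b`
odd: the free degrees are the literature seat's `standardConjectureBStar_iff_inverseLefschetz`, the even degrees §1 applied to
`*_L : H^{2n−b} → H^b` itself, the odd degrees the zero correspondence. (Kleiman: `B` for varieties with algebraic
cohomology — Grassmannians, flag varieties; here on the carriers, polarisation-free.)
[cite: Kleiman1968AlgebraicCycles, §2] [cite: Grothendieck1968, §3 p. 196 (B(X))] -/
theorem standardConjectureBStar_of_algebraicClasses_eq_top (hX : IsSmoothProjective n X)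
    (heven : ∀ β : ℕ, 2 ≤ 2 * β → 2 * β < n → algebraicClasses X β = ⊤)
    (hodd : ∀ b : ℕ, Odd b → 2 ≤ b → b < n → Subsingleton (complexBetti X b)) (η : complexBetti X 2) :
    StandardConjectureBStar n X η := by
  refine (standardConjectureBStar_iff_inverseLefschetz hX η).2 fun hη a b hab ha hb ↦ ?_
  rcases Nat.even_or_odd b with ⟨β, hβ⟩ | hbo
  · obtain rfl : b = 2 * β := by omega
    exact isAlgebraicCorrespondence_of_algebraicClasses_eq_top hX (by omega) (heven β hb (by omega)) _
  · haveI := hodd b hbo hb (by omega)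
    have h0 : lefschetzInvolution hη.hasHardLefschetz hab = 0 := Subsingleton.elim _ _
    rw [h0]
    exact isAlgebraicCorrespondence_zero hX hX (e := b) (by omega) (by omega)

/-- **`B⋆(X, η)` for EVERY smooth projective complex THREEFOLD `X` with `H²(X(ℂ); ℂ) = N¹H²` and every `η`, UNCONDITIONALLY**
(the one non-free degree of a threefold is `*_L : H⁴ → H²`): e.g. threefolds with `h^{2,0} = 0` once their `H²` is known to
be spanned by divisor classes. [cite: Kleiman1968AlgebraicCycles, §2] [cite: Tankeev2011, main theorem (for comparison: κ(X) < 3 in print)] -/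
theorem standardConjectureBStar_threefold_of_algebraicClasses_one (hX : IsSmoothProjective 3 X)
    (h₂ : algebraicClasses X 1 = ⊤) (η : complexBetti X 2) : StandardConjectureBStar 3 X η :=
  standardConjectureBStar_of_algebraicClasses_eq_top hX
    (fun β h2 hlt ↦ by
      obtain rfl : β = 1 := by omega
      exact h₂)
    (fun b hbo h2 hlt ↦ by
      exfalso
      obtain ⟨k, rfl⟩ := hbo
      omega) η

/-- **`B⋆(X, η)` for every smooth projective complex FOURFOLD with `H²(X(ℂ); ℂ) = N¹H²` and `H³(X(ℂ); ℂ) = 0`, every `η`,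
UNCONDITIONALLY** (non-free degrees `*_L : H⁶ → H²` and `H⁵ → H³`). [cite: Kleiman1968AlgebraicCycles, §2]
[cite: Grothendieck1968, §3 p. 196 (B(X))] -/
theorem standardConjectureBStar_fourfold_of_algebraicClasses_one (hX : IsSmoothProjective 4 X)
    (h₂ : algebraicClasses X 1 = ⊤) (h₃ : Subsingleton (complexBetti X 3)) (η : complexBetti X 2) :
    StandardConjectureBStar 4 X η :=
  standardConjectureBStar_of_algebraicClasses_eq_top hX
    (fun β h2 hlt ↦ by
      obtain rfl : β = 1 := by omega
      exact h₂)
    (fun b hbo h2 hlt ↦ by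
      obtain rfl : b = 3 := by
        obtain ⟨k, rfl⟩ := hbo
        omega
      exact h₃) η

/-! ## §3 The Hodge-type form: threefolds and fourfolds with no transcendental degree-2 class (`h^{2,0} = 0`) -/

/-- **`H²(X(ℂ); ℂ) = N¹H²` as soon as every RATIONAL degree-2 class is of type `(1,1)`** (i.e. `h^{2,0}(X) = 0` in the
tree's typing): rational classes span `H²` (the tree's `span_isRationalClass_eq_top_of_isSmoothProjective_holds`) and rational
`(1,1)` classes are algebraic (Lefschetz `(1,1)`, the tree's `lefschetzOneOne_rational_holds`).
[cite: VoisinHodgeI2002, §7.1.1 and Thm. 11.30 (Lefschetz (1,1))] -/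
theorem algebraicClasses_one_eq_top_of_forall_isOfHodgeType (hX : IsSmoothProjective n X)
    (h11 : ∀ c : complexBetti X (2 * 1), IsRationalClass c → IsOfHodgeType n X (2 * 1) 1 1 c) :
    algebraicClasses X 1 = ⊤ := by
  refine eq_top_iff.2 ?_
  rw [← span_isRationalClass_eq_top_of_isSmoothProjective_holds n X hX (2 * 1)]
  exact Submodule.span_le.2 fun c hc ↦ lefschetzOneOne_rational_holds hX c hc (h11 c hc)

/-- **`B⋆(X, η)` for EVERY smooth projective complex THREEFOLD without transcendental degree-2 classes (`h^{2,0}(X) = 0`: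
every rational class of `H²(X(ℂ))` is of type `(1,1)`), every `η`, UNCONDITIONALLY** — Fano threefolds, Calabi–Yau and
other threefolds with `p_g`-type vanishing in degree 2, once the `(1,1)` hypothesis is supplied.
[cite: Kleiman1968AlgebraicCycles, §2] [cite: VoisinHodgeI2002, Thm. 11.30] -/
theorem standardConjectureBStar_threefold_of_forall_isOfHodgeType_one_one (hX : IsSmoothProjective 3 X)
    (h11 : ∀ c : complexBetti X (2 * 1), IsRationalClass c → IsOfHodgeType 3 X (2 * 1) 1 1 c) (η : complexBetti X 2) :
    StandardConjectureBStar 3 X η :=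
  standardConjectureBStar_threefold_of_algebraicClasses_one hX
    (algebraicClasses_one_eq_top_of_forall_isOfHodgeType hX h11) η

/-- **`B⋆(X, η)` for every smooth projective complex FOURFOLD with `h^{2,0} = 0` (every rational degree-2 class of type
`(1,1)`) and `H³(X(ℂ); ℂ) = 0`, every `η`, UNCONDITIONALLY.** [cite: Kleiman1968AlgebraicCycles, §2] [cite: VoisinHodgeI2002, Thm. 11.30] -/
theorem standardConjectureBStar_fourfold_of_forall_isOfHodgeType_one_one (hX : IsSmoothProjective 4 X)
    (h11 : ∀ c : complexBetti X (2 * 1), IsRationalClass c → IsOfHodgeType 4 X (2 * 1) 1 1 c)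
    (h₃ : Subsingleton (complexBetti X 3)) (η : complexBetti X 2) : StandardConjectureBStar 4 X η :=
  standardConjectureBStar_fourfold_of_algebraicClasses_one hX
    (algebraicClasses_one_eq_top_of_forall_isOfHodgeType hX h11) h₃ η

end Summit.HodgeConjecture.HodgeConjecture.Theorems

end
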